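import Summits.Ventures.AbcShadow.SH01.Row

/-!
# Venture AbcShadow — BRIDGE for row SH-01: the target in print's shortest phrasing ("coprime integers `x, y, z`")

HONEST FRAMING. Bookkeeping file of the work-bound cell `abc-shadow` (typer seat `abc-shadow-typ-1`); no new hypothesis,
no new definition, no claim on abc or on any summit, no side on IUT. [Kra11, Thm 1.1] and [BVY04] phrase the conclusion as
"no solutions in coprime integers `x, y, z` with `|xy| > 1`". `SH01` (`SH01/Statement.lean`) asks for `x, y, Cz` PAIRWISE
coprime (print's standing convention, [BVY04, p. 1401]). This file proves, unconditionally, that the two phrasings agree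
for the equation `xⁿ + yⁿ = C z³` (`n ≥ 1`): `(x, y) = 1` already forces `(x, Cz) = (y, Cz) = 1` (`isCoprime_of_eq_SH01`,
`SH01_iff_coprimeForm`), and restates the row theorem `sh01_of` in that shape (`sh01_coprimeForm_of`). Words of the row:
typed/kernel-checked REDUCTION; the newform data is COMPUTED (certificate 4a36c28685fe0350) and enters as the hypothesis
`DataComplete`; print inputs are NAMED hypotheses; adjacent, NOT abc.
-/

namespace Summit.Ventures.AbcShadow

/-- For `xⁿ + yⁿ = C z³` with `n ≥ 1`, coprimality of `x, y` forces `x, Cz` and `y, Cz` coprime. [folklore] -/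
theorem isCoprime_of_eq_SH01 (C n : ℕ) (hn : 0 < n) (x y z : ℤ) (heq : x ^ n + y ^ n = (C : ℤ) * z ^ 3)
    (hxy : IsCoprime x y) : IsCoprime x ((C : ℤ) * z) ∧ IsCoprime y ((C : ℤ) * z) := by
  have key : ∀ u v : ℤ, u ^ n + v ^ n = (C : ℤ) * z ^ 3 → IsCoprime u v → IsCoprime u ((C : ℤ) * z) := by
    intro u v huv hc
    have h2 : IsCoprime (u ^ n) (v ^ n + u ^ n * 1) := hc.pow.add_mul_left_right 1
    have h3 : IsCoprime (u ^ n) ((C : ℤ) * z * z ^ 2) := by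
      have : v ^ n + u ^ n * 1 = (C : ℤ) * z * z ^ 2 := by linear_combination huv
      rwa [this] at h2
    exact (IsCoprime.pow_left_iff hn).mp h3.of_mul_right_left
  exact ⟨key x y heq hxy, key y x (by linear_combination heq) hxy.symm⟩

/-- The SHORT phrasing of the row target: no solution of `xⁿ + yⁿ = C z³` in integers with `(x, y) = 1` and `x y z ≠ 0`
(Krawciów: "no non-trivial solutions in coprime integers `x, y` and `z`"). [cite: Krawciow2011, Thm 1.1 (phrasing)] -/
theorem SH01_iff_coprimeForm : SH01 ↔
    ∀ C ∈ ({6, 12, 18, 36} : Finset ℕ), ∀ n : ℕ, n.Prime → 5 ≤ n →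
      ∀ x y z : ℤ, x ^ n + y ^ n = (C : ℤ) * z ^ 3 → IsCoprime x y → x * y * z ≠ 0 → False := by
  constructor
  · intro h C hC n hn h5 x y z heq hxy hne
    obtain ⟨hxz, hyz⟩ := isCoprime_of_eq_SH01 C n hn.pos x y z heq hxy
    exact h C hC n hn h5 x y z heq hxy hxz hyz hne
  · intro h C hC n hn h5 x y z heq hxy _ _ hne
    exact h C hC n hn h5 x y z heq hxy hne

/-- **Row SH-01 in the short phrasing**: under the named hypotheses of `sh01_of` (cited [BVY04] package, Prop 4.3, the two
p. 1407 rank inputs; COMPUTED `DataComplete 972` + `CMBy`), for every `C ∈ {6, 12, 18, 36}`, every prime `n ≥ 5` and all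
integers with `(x, y) = 1`, `x y z ≠ 0`: `xⁿ + yⁿ ≠ C z³`. ADJACENT, NOT abc.
[cite: Krawciow2011, Thm 1.1 (sharpened to every prime n ≥ 5, conditionally on the named inputs)] -/
theorem sh01_coprimeForm_of (M : CMNewformModel) (hP : M.BVY04Package) (h43 : M.BVY04Prop43)
    (hJ21 : M.BVY04RankInput21) (hJ39 : M.BVY04RankInput39)
    (hD : M.DataComplete 972 level972Orbits) (hCM : M.CMBy 972 level972CMOrbits (-3))
    (C : ℕ) (hC : C ∈ ({6, 12, 18, 36} : Finset ℕ)) (n : ℕ) (hn : n.Prime) (h5 : 5 ≤ n)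
    (x y z : ℤ) (heq : x ^ n + y ^ n = (C : ℤ) * z ^ 3) (hxy : IsCoprime x y) (hne : x * y * z ≠ 0) : False :=
  SH01_iff_coprimeForm.mp (sh01_of M hP h43 hJ21 hJ39 hD hCM) C hC n hn h5 x y z heq hxy hne

end Summit.Ventures.AbcShadow
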